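import Mathlib
import Summits.KontsevichZagierPeriods.KontsevichZagierPeriods.Theorems.InverseLandauTateLiftingRotationEngine
import Summits.KontsevichZagierPeriods.KontsevichZagierPeriods.Theorems.InverseLandauTateLiftingRotationSplit
import Summits.KontsevichZagierPeriods.KontsevichZagierPeriods.Theorems.InverseLandauTateLiftingRevolutionBand
import Summits.KontsevichZagierPeriods.KontsevichZagierPeriods.Theorems.InverseLandauTateLiftingGenusZeroSector
import Summits.KontsevichZagierPeriods.KontsevichZagierPeriods.Theorems.CompiledSubstitutionsPiNormalisation
import Literature.NumberTheory.Transcendental.KZProductIdeal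

/-!
# `TateLifting` (stmt-KontsevichZagierPeriods-9129), line `Sketch` — the ROTATION SECTOR (assembly I)

SYMMETRY AS A MOVE (continuation lead c8). If the domain and the integrand of a representation
`r = [σ, f]` of dimension `n + 2` are invariant under the rotations of the last two coordinates, then
`[r] ≡ [m]·[disc]` modulo `KZ.relations`, where `m = [M, 2ρ·f(v,ρ,0)]` is the honest MERIDIAN over
`M = {(v, ρ) | ρ > 0, (v, ρ, 0) ∈ σ}` (`rotation_reduce`: the rotation engine `tateLifting_rotationEngine` —
one rule-(2) move along the tan-half-angle chart after a co-null excision — the Fubini splitting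
`tateLifting_rotationSplit`, and the tree's `PiNormalisation`, `[ℝ, du/(1+u²)] ∼ [disc]`). Consequences:

* `kernel_of_reduce_mul` / `rotationKernel` — KERNEL TRANSFER: if the kernel form of Kontsevich–Zagier's
  Conjecture 1 holds on the subgroup generated by a set `S`, it holds on the subgroup generated by any set of
  rotation-invariant representations whose meridians reduce to `closure S` — with NO transcendence input
  (`eval` is multiplicative, `KZ.eval_mul'`, and `π ≠ 0` cancels);
* `revolution_reduce` / `revolutionKernel` — integrand-`1` SOLIDS OF REVOLUTION
  `{(v, y, z) | v ∈ τ, α(v)² ≤ y² + z² ≤ β(v)²}` (`0 ≤ α ≤ β` semialgebraic on `τ`): `[σ, 1] ≡ [τ, β² − α²]·[disc]`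
  (`tateLifting_revolutionBand`, one Newton–Leibniz move), and the kernel transfer for them;
* `conicRevolutionKernel`, `kzPeriodConjecture_conicRevolution` — with conic arcs `α = A(x, √q(x))`,
  `β = B(x, √q(x))` over `K = ℚ̄ ∩ ℝ` and the landed genus-zero kernel `genusZeroLowDimKernel` (Baker inside
  the calculus): **CONJECTURE 1 (kernel form) ON ALL SOLIDS OF REVOLUTION OF CONIC BANDS** — balls, shells,
  caps and zones, cones, frusta, cylinders, paraboloid / hyperboloid segments, ellipsoids of revolution,
  tori: two such solids with the same volume are KZ-equivalent (Archimedes' sphere : cylinder : cone and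
  Pappus–Guldin for conic meridians as accessible identities; the `2π·log`-valued solids included);
* `TateLifting_rotationSector` — the crux on these sectors.

References: M. Kontsevich, D. Zagier, *Periods* (2001), §1.2 (Conjecture 1, rules (1)–(3)), §4.1
(products); A. Baker, *Transcendental Number Theory* (1975), Thm 2.1 (through `genusZeroLowDimKernel`).
-/

noncomputable section

open MeasureTheory Set
open Literature.NumberTheory.Transcendental
open Literature.ModelTheory.ExponentialFields (IsSemialgebraic)

namespace Summit.KontsevichZagierPeriods.InverseLandau

namespace RotationSector

/-- `[ℝ, du/(1+u²)] ∼ [disc]` — the tree's `PiNormalisation` (route CompiledSubstitutions, proved).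
[cite: KontsevichZagier2001, §1.1 eq. (1)] -/
theorem arctan_sub_piRep_mem_relations (c : KZ.IntegralRep 1) (hcd : c.domain = Set.univ)
    (hci : c.integrand = fun u => 1 / (1 + u 0 ^ 2)) :
    KZ.of c - KZ.of KZ.piRep ∈ KZ.relations :=
  (Summit.KontsevichZagierPeriods.CompiledSubstitutions.PiNormalisation.piNormalisation_proof KZ.piRep rfl
    (fun _ _ => rfl)).1 c hcd (fun x _ => by rw [hci])

/-- **Kernel transfer along reductions with a common non-zero factor**: if every generator of `B` is
`≡ ℓ · t` modulo relations with `ℓ ∈ closure S` and a FIXED `t` of non-zero value, and the kernel form of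
Conjecture 1 holds on `closure S`, then it holds on `closure B` (`eval` is multiplicative, `KZ.eval_mul'`;
`relations` is a right ideal, `KZ.mul_mem_relations_right_holds`). No transcendence input.
[cite: KontsevichZagier2001, §1.2] -/
theorem kernel_of_reduce_mul {B S : Set KZ.FormalRep} (t : KZ.FormalRep) (ht : KZ.eval t ≠ 0)
    (hred : ∀ d ∈ B, ∃ ℓ ∈ AddSubgroup.closure S, d - ℓ * t ∈ KZ.relations)
    (hS : ∀ c ∈ AddSubgroup.closure S, KZ.eval c = 0 → c ∈ KZ.relations) :
    ∀ c ∈ AddSubgroup.closure B, KZ.eval c = 0 → c ∈ KZ.relations := by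
  intro c hc hev
  classical
  rw [← Submodule.span_int_eq_addSubgroupClosure, Submodule.mem_toAddSubgroup,
    Submodule.mem_span_set'] at hc
  obtain ⟨k, f, g, rfl⟩ := hc
  choose ℓ hℓ hrel using fun i => hred (g i) (g i).2
  have hdiff : ∑ i, f i • ((g i : KZ.FormalRep)) - (∑ i, f i • ℓ i) * t ∈ KZ.relations := by
    rw [Finset.sum_mul, ← Finset.sum_sub_distrib]
    refine sum_mem fun i _ => ?_
    rw [smul_mul_assoc, ← smul_sub]
    exact KZ.relations.zsmul_mem (hrel i) _
  have hmem : ∑ i, f i • ℓ i ∈ AddSubgroup.closure S :=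
    sum_mem fun i _ => AddSubgroup.zsmul_mem _ (hℓ i) _
  have hev' : KZ.eval (∑ i, f i • ℓ i) = 0 := by
    have h0 := KZ.relations_le_ker_eval_holds hdiff
    rw [AddMonoidHom.mem_ker, map_sub, hev, zero_sub, neg_eq_zero, KZ.eval_mul'] at h0
    exact (mul_eq_zero.1 h0).resolve_right ht
  have h := KZ.relations.add_mem hdiff (KZ.mul_mem_relations_right_holds _ t (hS _ hmem hev'))
  rwa [sub_add_cancel] at h

end RotationSector

open RotationSector

/-- **ROTATION REDUCTION.** A representation of dimension `n + 2` invariant under the rotations of its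
last two coordinates differs by relations from `[m]·[disc]`, `m = [M, 2ρ·f(v,ρ,0)]` the honest meridian
(`tateLifting_rotationEngine` + `tateLifting_rotationSplit` + `PiNormalisation`).
[cite: KontsevichZagier2001, §1.2 rule (2)] -/
theorem rotation_reduce {n : ℕ} (r : KZ.IntegralRep (n + 2))
    (hinv : ∀ x ∈ r.domain, ∀ c s : ℝ, c ^ 2 + s ^ 2 = 1 →
      (Fin.snoc (Fin.snoc (Fin.init (Fin.init x : Fin (n + 1) → ℝ) : Fin n → ℝ)
          (c * (Fin.init x : Fin (n + 1) → ℝ) (Fin.last n) - s * x (Fin.last (n + 1))) :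
            Fin (n + 1) → ℝ)
          (s * (Fin.init x : Fin (n + 1) → ℝ) (Fin.last n) + c * x (Fin.last (n + 1))) :
          Fin (n + 2) → ℝ) ∈ r.domain ∧
      r.integrand (Fin.snoc (Fin.snoc (Fin.init (Fin.init x : Fin (n + 1) → ℝ) : Fin n → ℝ)
          (c * (Fin.init x : Fin (n + 1) → ℝ) (Fin.last n) - s * x (Fin.last (n + 1))) :
            Fin (n + 1) → ℝ)
          (s * (Fin.init x : Fin (n + 1) → ℝ) (Fin.last n) + c * x (Fin.last (n + 1))) :
          Fin (n + 2) → ℝ) = r.integrand x) :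
    ∃ m : KZ.IntegralRep (n + 1),
      m.domain = {p | 0 < p (Fin.last n) ∧ (Fin.snoc p 0 : Fin (n + 2) → ℝ) ∈ r.domain} ∧
      (m.integrand = fun p => 2 * p (Fin.last n) * r.integrand (Fin.snoc p 0 : Fin (n + 2) → ℝ)) ∧
      KZ.of r - KZ.of m * KZ.of KZ.piRep ∈ KZ.relations := by
  obtain ⟨q, hqd, hqi, hrq⟩ := tateLifting_rotationEngine n r hinv
  obtain ⟨m, c, hmd, hmi, hcd, hci, hqmc⟩ := tateLifting_rotationSplit n r q hqd hqi
  refine ⟨m, hmd, hmi, ?_⟩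
  have hc : KZ.of m * KZ.of c - KZ.of m * KZ.of KZ.piRep ∈ KZ.relations := by
    rw [← mul_sub]
    exact KZ.of_mul_mem_relations m (arctan_sub_piRep_mem_relations c hcd hci)
  have : KZ.of r - KZ.of m * KZ.of KZ.piRep =
      (KZ.of r - KZ.of q) + (KZ.of q - KZ.of m * KZ.of c) + (KZ.of m * KZ.of c - KZ.of m * KZ.of KZ.piRep) := by
    abel
  rw [this]
  exact KZ.relations.add_mem (KZ.relations.add_mem hrq hqmc) hc

/-- **ROTATION KERNEL TRANSFER.** Let `S`, `B` be sets of formal combinations such that every element of `B`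
is the class of a representation of some dimension `n + 2`, invariant under the rotations of its last two
coordinates, together with an honest meridian (domain `M = {ρ > 0, (v, ρ, 0) ∈ σ}`, integrand `2ρ·f(v,ρ,0)`
there) which reduces to `closure S` modulo relations. If Conjecture 1 (kernel form) holds on `closure S`,
it holds on `closure B` — with NO transcendence input (the common factor `⟦π⟧` cancels).
[cite: KontsevichZagier2001, §1.2] -/
theorem rotationKernel :
    ∀ (S B : Set KZ.FormalRep),
    (∀ d ∈ B, ∃ (n : ℕ) (r : KZ.IntegralRep (n + 2)) (m : KZ.IntegralRep (n + 1)),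
      (∀ x ∈ r.domain, ∀ c s : ℝ, c ^ 2 + s ^ 2 = 1 →
        (Fin.snoc (Fin.snoc (Fin.init (Fin.init x : Fin (n + 1) → ℝ) : Fin n → ℝ)
            (c * (Fin.init x : Fin (n + 1) → ℝ) (Fin.last n) - s * x (Fin.last (n + 1))) :
              Fin (n + 1) → ℝ)
            (s * (Fin.init x : Fin (n + 1) → ℝ) (Fin.last n) + c * x (Fin.last (n + 1))) :
            Fin (n + 2) → ℝ) ∈ r.domain ∧
        r.integrand (Fin.snoc (Fin.snoc (Fin.init (Fin.init x : Fin (n + 1) → ℝ) : Fin n → ℝ)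
            (c * (Fin.init x : Fin (n + 1) → ℝ) (Fin.last n) - s * x (Fin.last (n + 1))) :
              Fin (n + 1) → ℝ)
            (s * (Fin.init x : Fin (n + 1) → ℝ) (Fin.last n) + c * x (Fin.last (n + 1))) :
            Fin (n + 2) → ℝ) = r.integrand x) ∧
      m.domain = {p | 0 < p (Fin.last n) ∧ (Fin.snoc p 0 : Fin (n + 2) → ℝ) ∈ r.domain} ∧
      Set.EqOn m.integrand (fun p => 2 * p (Fin.last n) * r.integrand (Fin.snoc p 0 : Fin (n + 2) → ℝ))
        m.domain ∧
      (∃ ℓ ∈ AddSubgroup.closure S, KZ.of m - ℓ ∈ KZ.relations) ∧ d = KZ.of r) →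
    (∀ c ∈ AddSubgroup.closure S, KZ.eval c = 0 → c ∈ KZ.relations) →
    ∀ c ∈ AddSubgroup.closure B, KZ.eval c = 0 → c ∈ KZ.relations := by
  intro S B hB hK
  refine kernel_of_reduce_mul (KZ.of KZ.piRep) (by rw [KZ.eval_of_piRep]; exact Real.pi_ne_zero)
    (fun d hd => ?_) hK
  obtain ⟨n, r, m, hinv, hmd, hmi, ⟨ℓ, hℓ, hmℓ⟩, rfl⟩ := hB d hd
  obtain ⟨m', hm'd, hm'i, hred⟩ := rotation_reduce r hinv
  refine ⟨ℓ, hℓ, ?_⟩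
  have hmm' : KZ.of m' - KZ.of m ∈ KZ.relations :=
    KZ.of_sub_of_mem_relations_of_eqOn (by rw [hmd, hm'd]) fun p hp => by
      rw [hm'i]
      exact (hmi (by rw [hmd, ← hm'd]; exact hp)).symm
  have h1 : KZ.of m' * KZ.of KZ.piRep - ℓ * KZ.of KZ.piRep ∈ KZ.relations := by
    rw [← sub_mul]
    refine KZ.mul_mem_relations_right_holds _ _ ?_
    have := KZ.relations.add_mem hmm' hmℓ
    rwa [sub_add_sub_cancel] at this
  have : KZ.of r - ℓ * KZ.of KZ.piRep =
      (KZ.of r - KZ.of m' * KZ.of KZ.piRep) + (KZ.of m' * KZ.of KZ.piRep - ℓ * KZ.of KZ.piRep) := by abel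
  rw [this]
  exact KZ.relations.add_mem hred h1

/-! ## Solids of revolution -/

/-- **REDUCTION OF A SOLID OF REVOLUTION**: for the integrand-`1` representation over
`σ = {(v, y, z) | v ∈ τ, α(v)² ≤ y² + z² ≤ β(v)²}` (`0 ≤ α ≤ β` `ℚ`-semialgebraic on the `ℚ`-semialgebraic
`τ ⊆ ℝⁿ`), the honest base representation `b = [τ, β² − α²]` exists and `[σ, 1] ≡ [b]·[disc]` modulo
relations (rotation reduction + `tateLifting_revolutionBand`). [cite: KontsevichZagier2001, §1.2] -/
theorem revolution_reduce {n : ℕ} (r : KZ.IntegralRep (n + 2)) (τ : Set (Fin n → ℝ)) (α β : (Fin n → ℝ) → ℝ)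
    (hτ : IsSemialgebraic ℚ τ) (hα : IsSemialgebraicFunOn ℚ τ α) (hβ : IsSemialgebraicFunOn ℚ τ β)
    (hα0 : ∀ v ∈ τ, 0 ≤ α v) (hαβ : ∀ v ∈ τ, α v ≤ β v)
    (hdom : r.domain = {x | (Fin.init (Fin.init x : Fin (n + 1) → ℝ) : Fin n → ℝ) ∈ τ ∧
      α (Fin.init (Fin.init x : Fin (n + 1) → ℝ)) ^ 2 ≤
        (Fin.init x : Fin (n + 1) → ℝ) (Fin.last n) ^ 2 + x (Fin.last (n + 1)) ^ 2 ∧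
      (Fin.init x : Fin (n + 1) → ℝ) (Fin.last n) ^ 2 + x (Fin.last (n + 1)) ^ 2 ≤
        β (Fin.init (Fin.init x : Fin (n + 1) → ℝ)) ^ 2})
    (hint : Set.EqOn r.integrand (fun _ => 1) r.domain) :
    ∃ b : KZ.IntegralRep n, b.domain = τ ∧ (b.integrand = fun v => β v ^ 2 - α v ^ 2) ∧
      KZ.of r - KZ.of b * KZ.of KZ.piRep ∈ KZ.relations := by
  -- rotation invariance of the solid
  have key : ∀ c s y z : ℝ, c ^ 2 + s ^ 2 = 1 →
      (c * y - s * z) ^ 2 + (s * y + c * z) ^ 2 = y ^ 2 + z ^ 2 := fun c s y z hcs => by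
    linear_combination (y ^ 2 + z ^ 2) * hcs
  have hinv : ∀ x ∈ r.domain, ∀ c s : ℝ, c ^ 2 + s ^ 2 = 1 →
      (Fin.snoc (Fin.snoc (Fin.init (Fin.init x : Fin (n + 1) → ℝ) : Fin n → ℝ)
          (c * (Fin.init x : Fin (n + 1) → ℝ) (Fin.last n) - s * x (Fin.last (n + 1))) :
            Fin (n + 1) → ℝ)
          (s * (Fin.init x : Fin (n + 1) → ℝ) (Fin.last n) + c * x (Fin.last (n + 1))) :
          Fin (n + 2) → ℝ) ∈ r.domain ∧
      r.integrand (Fin.snoc (Fin.snoc (Fin.init (Fin.init x : Fin (n + 1) → ℝ) : Fin n → ℝ)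
          (c * (Fin.init x : Fin (n + 1) → ℝ) (Fin.last n) - s * x (Fin.last (n + 1))) :
            Fin (n + 1) → ℝ)
          (s * (Fin.init x : Fin (n + 1) → ℝ) (Fin.last n) + c * x (Fin.last (n + 1))) :
          Fin (n + 2) → ℝ) = r.integrand x := by
    intro x hx c s hcs
    have hmem : (Fin.snoc (Fin.snoc (Fin.init (Fin.init x : Fin (n + 1) → ℝ) : Fin n → ℝ)
          (c * (Fin.init x : Fin (n + 1) → ℝ) (Fin.last n) - s * x (Fin.last (n + 1))) :
            Fin (n + 1) → ℝ)
          (s * (Fin.init x : Fin (n + 1) → ℝ) (Fin.last n) + c * x (Fin.last (n + 1))) :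
          Fin (n + 2) → ℝ) ∈ r.domain := by
      rw [hdom] at hx ⊢
      simp only [Set.mem_setOf_eq, Fin.init_snoc, Fin.snoc_last, key c s _ _ hcs]
      exact hx
    exact ⟨hmem, by rw [hint hmem, hint hx]⟩
  obtain ⟨m, hmd, hmi, hred⟩ := rotation_reduce r hinv
  have hmd' : m.domain = {p | (Fin.init p : Fin n → ℝ) ∈ τ ∧ 0 < p (Fin.last n) ∧
      α (Fin.init p) ≤ p (Fin.last n) ∧ p (Fin.last n) ≤ β (Fin.init p)} := by
    rw [hmd]
    ext p
    simp only [Set.mem_setOf_eq, hdom, Fin.init_snoc, Fin.snoc_last]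
    constructor
    · rintro ⟨hρ, hv, h1, h2⟩
      have hb0 : 0 ≤ β (Fin.init p) := (hα0 _ hv).trans (hαβ _ hv)
      refine ⟨hv, hρ, ?_, ?_⟩
      · nlinarith [hα0 _ hv]
      · nlinarith
    · rintro ⟨hv, hρ, h1, h2⟩
      refine ⟨hρ, hv, ?_, ?_⟩
      · nlinarith [hα0 _ hv]
      · nlinarith
  have hmi' : Set.EqOn m.integrand (fun p => 2 * p (Fin.last n)) m.domain := by
    intro p hp
    have hp' : (Fin.snoc p 0 : Fin (n + 2) → ℝ) ∈ r.domain := by rw [hmd] at hp; exact hp.2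
    simp only [hmi, hint hp', mul_one]
  obtain ⟨b, hbd, hbi, hmb⟩ := tateLifting_revolutionBand n m τ α β hτ hα hβ hα0 hαβ hmd' hmi'
  refine ⟨b, hbd, hbi, ?_⟩
  have h1 : KZ.of m * KZ.of KZ.piRep - KZ.of b * KZ.of KZ.piRep ∈ KZ.relations := by
    rw [← sub_mul]
    exact KZ.mul_mem_relations_right_holds _ _ hmb
  have : KZ.of r - KZ.of b * KZ.of KZ.piRep =
      (KZ.of r - KZ.of m * KZ.of KZ.piRep) + (KZ.of m * KZ.of KZ.piRep - KZ.of b * KZ.of KZ.piRep) := by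
    abel
  rw [this]
  exact KZ.relations.add_mem hred h1

/-- **KERNEL FORM ON SOLIDS OF REVOLUTION.** Let `S`, `B` be sets of formal combinations such that every
element of `B` is the class of an integrand-`1` solid of revolution whose base `[τ, β² − α²]` (any honest
one) reduces to `closure S` modulo relations. If Conjecture 1 (kernel form) holds on `closure S`, it holds
on `closure B`: two such solids with the same volume are KZ-equivalent. [cite: KontsevichZagier2001, §1.2] -/
theorem revolutionKernel (S B : Set KZ.FormalRep)
    (hB : ∀ d ∈ B, ∃ (n : ℕ) (r : KZ.IntegralRep (n + 2)) (τ : Set (Fin n → ℝ)) (α β : (Fin n → ℝ) → ℝ),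
      IsSemialgebraic ℚ τ ∧ IsSemialgebraicFunOn ℚ τ α ∧ IsSemialgebraicFunOn ℚ τ β ∧
      (∀ v ∈ τ, 0 ≤ α v) ∧ (∀ v ∈ τ, α v ≤ β v) ∧
      r.domain = {x | (Fin.init (Fin.init x : Fin (n + 1) → ℝ) : Fin n → ℝ) ∈ τ ∧
        α (Fin.init (Fin.init x : Fin (n + 1) → ℝ)) ^ 2 ≤
          (Fin.init x : Fin (n + 1) → ℝ) (Fin.last n) ^ 2 + x (Fin.last (n + 1)) ^ 2 ∧
        (Fin.init x : Fin (n + 1) → ℝ) (Fin.last n) ^ 2 + x (Fin.last (n + 1)) ^ 2 ≤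
          β (Fin.init (Fin.init x : Fin (n + 1) → ℝ)) ^ 2} ∧
      Set.EqOn r.integrand (fun _ => 1) r.domain ∧
      (∀ b : KZ.IntegralRep n, b.domain = τ → (b.integrand = fun v => β v ^ 2 - α v ^ 2) →
        ∃ ℓ ∈ AddSubgroup.closure S, KZ.of b - ℓ ∈ KZ.relations) ∧
      d = KZ.of r)
    (hK : ∀ c ∈ AddSubgroup.closure S, KZ.eval c = 0 → c ∈ KZ.relations) :
    ∀ c ∈ AddSubgroup.closure B, KZ.eval c = 0 → c ∈ KZ.relations := by
  refine kernel_of_reduce_mul (KZ.of KZ.piRep) (by rw [KZ.eval_of_piRep]; exact Real.pi_ne_zero)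
    (fun d hd => ?_) hK
  obtain ⟨n, r, τ, α, β, hτ, hα, hβ, hα0, hαβ, hdom, hint, hbase, rfl⟩ := hB d hd
  obtain ⟨b, hbd, hbi, hred⟩ := revolution_reduce r τ α β hτ hα hβ hα0 hαβ hdom hint
  obtain ⟨ℓ, hℓ, hbℓ⟩ := hbase b hbd hbi
  refine ⟨ℓ, hℓ, ?_⟩
  have h1 : KZ.of b * KZ.of KZ.piRep - ℓ * KZ.of KZ.piRep ∈ KZ.relations := by
    rw [← sub_mul]
    exact KZ.mul_mem_relations_right_holds _ _ hbℓ
  have : KZ.of r - ℓ * KZ.of KZ.piRep =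
      (KZ.of r - KZ.of b * KZ.of KZ.piRep) + (KZ.of b * KZ.of KZ.piRep - ℓ * KZ.of KZ.piRep) := by abel
  rw [this]
  exact KZ.relations.add_mem hred h1

/-- **CONJECTURE 1 ON THE SOLIDS OF REVOLUTION OF CONIC BANDS (kernel form).** Let `B` be any set of classes
of integrand-`1` representations over solids of revolution `{(x, y, z) | x ∈ τ, α(x)² ≤ y² + z² ≤ β(x)²}` with
conic arcs `0 ≤ α = A(x, √q(x)) ≤ β = B(x, √q(x))` (`A, B ∈ K(X, Y)`, `q = ax² + bx + c > 0` on the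
`ℚ`-semialgebraic `τ ⊆ ℝ`, `K = ℚ̄ ∩ ℝ`): balls, spherical shells, caps and zones, cones and frusta,
cylinders, paraboloid and hyperboloid segments, ellipsoids of revolution, tori. Every vanishing
`ℤ`-combination of elements of `B` is a relation of the Kontsevich–Zagier calculus (the base `[τ, β² − α²]`
is a conic representation, and `genusZeroLowDimKernel` — Baker inside the calculus).
[cite: KontsevichZagier2001, §1.2] -/
theorem conicRevolutionKernel :
    ∀ (B : Set KZ.FormalRep),
    (∀ d ∈ B, ∃ (a b c : algebraicClosure ℚ ℝ)
      (Pα Qα Pβ Qβ : MvPolynomial (Fin 2) (algebraicClosure ℚ ℝ)) (τ : Set (Fin 1 → ℝ))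
      (α β : (Fin 1 → ℝ) → ℝ) (r : KZ.IntegralRep 3),
      IsSemialgebraic ℚ τ ∧
      (∀ x ∈ τ, 0 < (a : ℝ) * x 0 ^ 2 + (b : ℝ) * x 0 + c) ∧
      (∀ x ∈ τ, (MvPolynomial.aeval ![x 0, Real.sqrt ((a : ℝ) * x 0 ^ 2 + (b : ℝ) * x 0 + c)] Qα : ℝ) ≠ 0) ∧
      (∀ x ∈ τ, (MvPolynomial.aeval ![x 0, Real.sqrt ((a : ℝ) * x 0 ^ 2 + (b : ℝ) * x 0 + c)] Qβ : ℝ) ≠ 0) ∧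
      (∀ x ∈ τ, α x =
        (MvPolynomial.aeval ![x 0, Real.sqrt ((a : ℝ) * x 0 ^ 2 + (b : ℝ) * x 0 + c)] Pα : ℝ) /
          MvPolynomial.aeval ![x 0, Real.sqrt ((a : ℝ) * x 0 ^ 2 + (b : ℝ) * x 0 + c)] Qα) ∧
      (∀ x ∈ τ, β x =
        (MvPolynomial.aeval ![x 0, Real.sqrt ((a : ℝ) * x 0 ^ 2 + (b : ℝ) * x 0 + c)] Pβ : ℝ) /
          MvPolynomial.aeval ![x 0, Real.sqrt ((a : ℝ) * x 0 ^ 2 + (b : ℝ) * x 0 + c)] Qβ) ∧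
      (∀ x ∈ τ, 0 ≤ α x) ∧ (∀ x ∈ τ, α x ≤ β x) ∧
      r.domain = {z | (Fin.init (Fin.init z : Fin 2 → ℝ) : Fin 1 → ℝ) ∈ τ ∧
        α (Fin.init (Fin.init z : Fin 2 → ℝ)) ^ 2 ≤ (Fin.init z : Fin 2 → ℝ) (Fin.last 1) ^ 2 + z (Fin.last 2) ^ 2 ∧
        (Fin.init z : Fin 2 → ℝ) (Fin.last 1) ^ 2 + z (Fin.last 2) ^ 2 ≤
          β (Fin.init (Fin.init z : Fin 2 → ℝ)) ^ 2} ∧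
      Set.EqOn r.integrand (fun _ => 1) r.domain ∧ d = KZ.of r) →
    ∀ c ∈ AddSubgroup.closure B, KZ.eval c = 0 → c ∈ KZ.relations := by
  intro B hB
  refine revolutionKernel _ B (fun d hd => ?_) genusZeroLowDimKernel
  obtain ⟨a, b, c, Pα, Qα, Pβ, Qβ, τ, α, β, r, hτ, hpos, hQα, hQβ, hα, hβ, hα0, hαβ, hdom, hint, rfl⟩ := hB d hd
  have hsq : IsSemialgebraicFunOn ℚ τ (fun x => Real.sqrt ((a : ℝ) * x 0 ^ 2 + (b : ℝ) * x 0 + c)) := by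
    have hq : IsSemialgebraicFunOn ℚ τ (fun x => (a : ℝ) * x 0 ^ 2 + (b : ℝ) * x 0 + c) := by
      refine (GenusZero.isSemialgebraicFunOn_aeval_pair hτ (isSemialgebraicFunOn_apply hτ 0)
        (MvPolynomial.C a * MvPolynomial.X 0 ^ 2 + MvPolynomial.C b * MvPolynomial.X 0 + MvPolynomial.C c)).congr
        fun x _ => ?_
      simp [IntermediateField.algebraMap_apply]
    exact IsSemialgebraicFunOn.sqrt_holds hq
  have hαs : IsSemialgebraicFunOn ℚ τ α :=
    ((GenusZero.isSemialgebraicFunOn_aeval_pair hτ hsq Pα).div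
      (GenusZero.isSemialgebraicFunOn_aeval_pair hτ hsq Qα) hQα).congr fun x hx => (hα x hx).symm
  have hβs : IsSemialgebraicFunOn ℚ τ β :=
    ((GenusZero.isSemialgebraicFunOn_aeval_pair hτ hsq Pβ).div
      (GenusZero.isSemialgebraicFunOn_aeval_pair hτ hsq Qβ) hQβ).congr fun x hx => (hβ x hx).symm
  refine ⟨1, r, τ, α, β, hτ, hαs, hβs, hα0, hαβ, hdom, hint, fun b' hb'd hb'i => ?_, rfl⟩
  refine ⟨KZ.of b', AddSubgroup.subset_closure (Or.inl (Or.inr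
    ⟨a, b, c, Pβ ^ 2 * Qα ^ 2 - Pα ^ 2 * Qβ ^ 2, Qα ^ 2 * Qβ ^ 2, b', ?_, ?_, ?_, rfl⟩)),
    by rw [sub_self]; exact KZ.relations.zero_mem⟩
  · rw [hb'd]; exact hpos
  · rw [hb'd]
    intro x hx
    rw [map_mul, map_pow, map_pow]
    exact mul_ne_zero (pow_ne_zero _ (hQα x hx)) (pow_ne_zero _ (hQβ x hx))
  · rw [hb'd, hb'i]
    intro x hx
    simp only [map_sub, map_mul, map_pow]
    rw [hβ x hx, hα x hx, div_pow, div_pow,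
      div_sub_div _ _ (pow_ne_zero _ (hQβ x hx)) (pow_ne_zero _ (hQα x hx))]
    ring

/-- **Two solids of revolution of conic bands over `ℚ̄ ∩ ℝ` with the same volume are KZ-equivalent**
(Archimedes' sphere : cylinder : cone, Pappus–Guldin for conic meridians, …: the pair form of
`conicRevolutionKernel` on a two-element `B`). [cite: KontsevichZagier2001, §1.2] -/
theorem kzPeriodConjecture_conicRevolution (B : Set KZ.FormalRep)
    (hB : ∀ d ∈ B, ∃ (a b c : algebraicClosure ℚ ℝ)
      (Pα Qα Pβ Qβ : MvPolynomial (Fin 2) (algebraicClosure ℚ ℝ)) (τ : Set (Fin 1 → ℝ))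
      (α β : (Fin 1 → ℝ) → ℝ) (r : KZ.IntegralRep 3),
      IsSemialgebraic ℚ τ ∧
      (∀ x ∈ τ, 0 < (a : ℝ) * x 0 ^ 2 + (b : ℝ) * x 0 + c) ∧
      (∀ x ∈ τ, (MvPolynomial.aeval ![x 0, Real.sqrt ((a : ℝ) * x 0 ^ 2 + (b : ℝ) * x 0 + c)] Qα : ℝ) ≠ 0) ∧
      (∀ x ∈ τ, (MvPolynomial.aeval ![x 0, Real.sqrt ((a : ℝ) * x 0 ^ 2 + (b : ℝ) * x 0 + c)] Qβ : ℝ) ≠ 0) ∧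
      (∀ x ∈ τ, α x =
        (MvPolynomial.aeval ![x 0, Real.sqrt ((a : ℝ) * x 0 ^ 2 + (b : ℝ) * x 0 + c)] Pα : ℝ) /
          MvPolynomial.aeval ![x 0, Real.sqrt ((a : ℝ) * x 0 ^ 2 + (b : ℝ) * x 0 + c)] Qα) ∧
      (∀ x ∈ τ, β x =
        (MvPolynomial.aeval ![x 0, Real.sqrt ((a : ℝ) * x 0 ^ 2 + (b : ℝ) * x 0 + c)] Pβ : ℝ) /
          MvPolynomial.aeval ![x 0, Real.sqrt ((a : ℝ) * x 0 ^ 2 + (b : ℝ) * x 0 + c)] Qβ) ∧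
      (∀ x ∈ τ, 0 ≤ α x) ∧ (∀ x ∈ τ, α x ≤ β x) ∧
      r.domain = {z | (Fin.init (Fin.init z : Fin 2 → ℝ) : Fin 1 → ℝ) ∈ τ ∧
        α (Fin.init (Fin.init z : Fin 2 → ℝ)) ^ 2 ≤ (Fin.init z : Fin 2 → ℝ) (Fin.last 1) ^ 2 + z (Fin.last 2) ^ 2 ∧
        (Fin.init z : Fin 2 → ℝ) (Fin.last 1) ^ 2 + z (Fin.last 2) ^ 2 ≤
          β (Fin.init (Fin.init z : Fin 2 → ℝ)) ^ 2} ∧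
      Set.EqOn r.integrand (fun _ => 1) r.domain ∧ d = KZ.of r)
    {r r' : KZ.IntegralRep 3} (hr : KZ.of r ∈ B) (hr' : KZ.of r' ∈ B) (hv : r.value = r'.value) :
    KZ.Equivalent r r' :=
  conicRevolutionKernel B hB _ (sub_mem (AddSubgroup.subset_closure hr) (AddSubgroup.subset_closure hr'))
    (by rw [map_sub, KZ.eval_of, KZ.eval_of, hv, sub_self])

/-- **The crux on the rotation sectors**: every vanishing combination covered by `rotationKernel` lies in
`KZ.relations ⊔ closure T` for any `T` (indeed in `KZ.relations`). [cite: KontsevichZagier2001, §1.2] -/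
theorem TateLifting_rotationSector (S B : Set KZ.FormalRep)
    (hB : ∀ d ∈ B, ∃ (n : ℕ) (r : KZ.IntegralRep (n + 2)) (m : KZ.IntegralRep (n + 1)),
      (∀ x ∈ r.domain, ∀ c s : ℝ, c ^ 2 + s ^ 2 = 1 →
        (Fin.snoc (Fin.snoc (Fin.init (Fin.init x : Fin (n + 1) → ℝ) : Fin n → ℝ)
            (c * (Fin.init x : Fin (n + 1) → ℝ) (Fin.last n) - s * x (Fin.last (n + 1))) :
              Fin (n + 1) → ℝ)
            (s * (Fin.init x : Fin (n + 1) → ℝ) (Fin.last n) + c * x (Fin.last (n + 1))) :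
            Fin (n + 2) → ℝ) ∈ r.domain ∧
        r.integrand (Fin.snoc (Fin.snoc (Fin.init (Fin.init x : Fin (n + 1) → ℝ) : Fin n → ℝ)
            (c * (Fin.init x : Fin (n + 1) → ℝ) (Fin.last n) - s * x (Fin.last (n + 1))) :
              Fin (n + 1) → ℝ)
            (s * (Fin.init x : Fin (n + 1) → ℝ) (Fin.last n) + c * x (Fin.last (n + 1))) :
            Fin (n + 2) → ℝ) = r.integrand x) ∧
      m.domain = {p | 0 < p (Fin.last n) ∧ (Fin.snoc p 0 : Fin (n + 2) → ℝ) ∈ r.domain} ∧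
      Set.EqOn m.integrand (fun p => 2 * p (Fin.last n) * r.integrand (Fin.snoc p 0 : Fin (n + 2) → ℝ))
        m.domain ∧
      (∃ ℓ ∈ AddSubgroup.closure S, KZ.of m - ℓ ∈ KZ.relations) ∧ d = KZ.of r)
    (hK : ∀ c ∈ AddSubgroup.closure S, KZ.eval c = 0 → c ∈ KZ.relations) (T : Set KZ.FormalRep) :
    ∀ c ∈ AddSubgroup.closure B, KZ.eval c = 0 → c ∈ KZ.relations ⊔ AddSubgroup.closure T :=
  fun c hc h0 => AddSubgroup.mem_sup_left (rotationKernel S B hB hK c hc h0)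

end Summit.KontsevichZagierPeriods.InverseLandau
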